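import Summits.HodgeConjecture.HodgeConjecture.Theorems.F0P6aSpecOrgansT
import HarnessLib
import HarnessLib.Audit.LibrarySuggestionsDenyListCruxes

/-!
# F0_P6a_SpecOrgansT — ED. 2 = SHIM (K6 L2 column re-home; pen LA2-plan (g5) PLAN «L2 cone RE-HOME» v1.4; ★ parts by LA2-p02 (g5) R2; box LAref-D (g4) first ∕ LA-ref1 (g5) second; TEMPLATE by LA2-p03 (g7), DEAL 6 — the LEAD composes the K6 shim request, not L2)

Every declaration of the tree workfile `Lines/F0_P6a_SpecOrgansT.lean` (ED. 1, sha16 8dca47ee93439c08, 1023 l., sorry-free, stub-free; 16 declarations = 16 theorems + 0 def-like: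
`surjective_roofΩ_leg`, `exists_translCompositeΩ_of_legs`, `map_restrictPt_sectionBaseChange_of_lvlPtΩ`, `exists_translReduction_native_of_composite`, `exists_translReduction_native`, `exists_translReduction_at`, `exists_translReduction`, `red₀Of_eq_of_structuredIso₀`, `comp_eq_of_pow_rows`, `red₀Of_eq_of_common_source₀`, …, last head `red₀Of_quotΩ_eq_of_quotLegReduction₀`)
now lives, byte for byte and under the SAME namespace `Summit.HodgeConjecture.HodgeConjecture.Cruxes.HLiu418.F0P6aLineSpecialisation`, in the ★ chain
★ `Theorems/F0P6aSpecOrgansTBlockT5.lean` (p853252) → ★ `Theorems/F0P6aSpecOrgansTTranslReduction.lean` (p853283) → ★ `Theorems/F0P6aSpecOrgansTQuotQuotSheet.lean` (p853311) → ★ `Theorems/F0P6aSpecOrgansT.lean` (p853332) (LAST part = plain stem; each part imports the previous); this module keeps its name so that its tree importers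
(`Lines/F0_P6a_SpecOrgansU.lean`, `Lines/F0_P6a_StubFROBQuotWD.lean`, `Lines/F0_P6a_StubDOWN.lean`) and any by-name reader under `open …F0P6aLineSpecialisation` resolve unchanged through the import above.
It declares nothing.  No declaration was cut in the ★ twin (verbatim re-home) ⇒ nothing to alias.
ORDER NOTE: written in ONE request with the rest of the K6 L-cone shims on the LEAD՚s word after (K5-R) BUILT and after EVERY ★ part above is ACCEPTED (NO-CROSS-IMPORT: no environment may hold
a `Lines/` ORIGINAL of this column together with its ★ twin); an importer smoke that reads «environment already contains …» before that request is BUILT is this order note,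
not a defect.  Edition history stays in the line card `Lines/F0_P6a_SpecOrgansT.md` and in git; future changes are ★-side proposals on the `Theorems/` files.
HC_CM is proved only modulo the 7 printed citations (2 remaining named inputs: hLiu418 = stmt-HodgeConjecture-24832, h413 = stmt-HodgeConjecture-24833) until rung 0 closes; count-neutral (0 `sorry`, 0 socket, 0 declarations). -/
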